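import Literature.NumberTheory.DiophantineGeometry.ConductorAdditiveProofs
import Literature.NumberTheory.DiophantineGeometry.ConductorRadicalProofs
import Literature.NumberTheory.DiophantineGeometry.MinimalDiscriminantProofs
import Literature.NumberTheory.DiophantineGeometry.MinimalDiscriminantNormProofs
import Literature.NumberTheory.DiophantineGeometry.TateAlgorithmProofs
import Literature.NumberTheory.DiophantineGeometry.TateAlgorithmOrdDiscriminant
import Literature.NumberTheory.DiophantineGeometry.ConductorExponentLeTwoProofs
import Literature.NumberTheory.DiophantineGeometry.AbcWave0
import Literature.RingTheory.DiscreteValuationRing.AdicCompletionResidueField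
import Mathlib.NumberTheory.NumberField.Completion.FinitePlace
import Mathlib.NumberTheory.NumberField.Ideal.Basic
import HarnessLib

/-!
# `abc ⟹ Szpiro` over a number field, I: local minimality and valuation bookkeeping

Companion PROOF file (theorems only, no definitions) of `Literature.NumberTheory.EllipticCurves.Szpiro`
(`SzpiroConjectureOver K`, Silverman ATAEC Conj. IV.10.6) preparing the prime-by-prime form of
Silverman, *The Arithmetic of Elliptic Curves* (2nd ed. 2009), Prop. VIII.11.5(b) «abc implies Szpiro»
with Exercise 8.21, over an arbitrary number field `K` (where no global minimal model need exist, so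
everything is read off the LOCAL minimal model `W.localMinimalIntegralModel v` over
`O_v = v.adicCompletionIntegers K`):

* `WeierstrassCurve.smul_eq_shortModel`: the change of variables `u = e/6`, `r = −b₂/12`, `s = −a₁/2`,
  `t = −a₃/2 + a₁ b₂/24` to `y² = x³ − 27 c₄/e⁴ x − 54 c₆/e⁶` (AEC III.1), over any field of
  characteristic `0`;
* `WeierstrassCurve.valued_six_le_of_isMinimal`: for a MINIMAL equation over `K_v`, integrality of that
  model forces `|6|_v ≤ |e|_v` (AEC VII.1, definition of minimality);
* `WeierstrassCurve.localMinimal_ord_c₄_c₆_lt`: hence `ord_v c₄ < 4 ord_v 6 + 4` or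
  `ord_v c₆ < 6 ord_v 6 + 6` on the local minimal model (AEC VII.1 Rmk 1.1 / Ex. 8.21, uniformly in the
  residue characteristic);
* `WeierstrassCurve.algebraMap_c₄_cube_div`, `…c₆_sq_div`: `c₄³/(1728Δ) = j/1728` and `c₆²/(1728Δ)` are
  computed in `K_v` on the local minimal model;
* `SzpiroLocal.szpiro_local_core`: the integer inequality behind Ex. 8.21 (all reduction types),
  checked by linear arithmetic; `SzpiroLocal.log_max_one_finitePlace`: `log⁺‖y‖_v = max(0,k)·log N(v)`
  when `v(y) = exp k`.

## References

* J. H. Silverman, *The Arithmetic of Elliptic Curves*, GTM 106, 2nd ed. 2009, III.1, VII.1 (Rmk 1.1),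
  VIII.11 Prop. 11.5(b), Ex. 8.21. [SilvermanAEC2009]
* J. H. Silverman, *Advanced Topics in the Arithmetic of Elliptic Curves*, GTM 151, 1994, IV.10
  (Conj. 10.6). [Silverman1994]
-/

open IsDedekindDomain NumberField

namespace WeierstrassCurve

section ShortModel

variable {L : Type*} [Field L] [CharZero L]

/-- **The passage to `y² = x³ − 27 c₄ x − 54 c₆`, rescaled by `e`** (Silverman AEC III.1): over a
field of characteristic `0`, the change of variables `u = e/6`, `r = −b₂/12`, `s = −a₁/2`,
`t = −a₃/2 + a₁ b₂/24` carries `X` to `y² = x³ − (27 c₄/e⁴) x − 54 c₆/e⁶`.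
[cite: SilvermanAEC2009, III.1 (PDF p. 49)] -/
theorem smul_eq_shortModel (X : WeierstrassCurve L) {e : L} (he : e ≠ 0) :
    (⟨Units.mk0 (e / 6) (div_ne_zero he (by exact_mod_cast (by norm_num : (6:ℕ) ≠ 0))),
        -X.b₂ / 12, -X.a₁ / 2, -X.a₃ / 2 + X.a₁ * X.b₂ / 24⟩ : VariableChange L) • X =
      (⟨0, 0, 0, -27 * X.c₄ / e ^ 4, -54 * X.c₆ / e ^ 6⟩ : WeierstrassCurve L) := by
  ext
  · simp only [variableChange_a₁, Units.val_inv_eq_inv_val, Units.val_mk0]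
    field_simp
    ring
  · simp only [variableChange_a₂, Units.val_inv_eq_inv_val, Units.val_mk0, WeierstrassCurve.b₂]
    field_simp
    ring
  · simp only [variableChange_a₃, Units.val_inv_eq_inv_val, Units.val_mk0, WeierstrassCurve.b₂]
    field_simp
    ring
  · simp only [variableChange_a₄, Units.val_inv_eq_inv_val, Units.val_mk0, WeierstrassCurve.b₂,
      WeierstrassCurve.c₄, WeierstrassCurve.b₄]
    field_simp
    ring
  · simp only [variableChange_a₆, Units.val_inv_eq_inv_val, Units.val_mk0, WeierstrassCurve.b₂,
      WeierstrassCurve.c₆, WeierstrassCurve.b₄, WeierstrassCurve.b₆]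
    field_simp
    ring

end ShortModel

section MinimalBound

variable {A : Type*} [CommRing A] [IsDedekindDomain A] {K : Type*} [Field K] [CharZero K]
  [Algebra A K] [IsFractionRing A K] (v : HeightOneSpectrum A)

/-- `K_v` has characteristic zero when `K` does. [folklore] -/
private theorem charZero_adicCompletion_of_charZero : CharZero (v.adicCompletion K) :=
  charZero_of_injective_algebraMap (algebraMap K (v.adicCompletion K)).injective

/-- **Minimality bounds the rescaling** (Silverman AEC VII.1, definition of a minimal equation, with
III.1): if `X / K_v` is minimal with `Δ ≠ 0` and `|27 c₄|_v ≤ |e|_v⁴`, `|54 c₆|_v ≤ |e|_v⁶` (so that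
`y² = x³ − 27 c₄/e⁴ x − 54 c₆/e⁶` is `O_v`-integral, with discriminant `6¹² Δ / e¹²`), then
`|6|_v ≤ |e|_v`, i.e. `ord_v e ≤ ord_v 6`. [cite: SilvermanAEC2009, VII.1 (definition of minimality) and Ex. 8.21] -/
theorem valued_six_le_of_isMinimal (X : WeierstrassCurve (v.adicCompletion K))
    [hX : X.IsMinimal (v.adicCompletionIntegers K)] (hΔ : X.Δ ≠ 0)
    {e : v.adicCompletion K} (he : e ≠ 0)
    (h4 : Valued.v (27 * X.c₄) ≤ Valued.v e ^ 4) (h6 : Valued.v (54 * X.c₆) ≤ Valued.v e ^ 6) :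
    Valued.v (6 : v.adicCompletion K) ≤ Valued.v e := by
  haveI := charZero_adicCompletion_of_charZero (K := K) v
  have h6ne : (6 : v.adicCompletion K) ≠ 0 := by exact_mod_cast (by norm_num : (6:ℕ) ≠ 0)
  obtain ⟨-, hmin⟩ := (isMinimal_iff_of_le_one_iff
    (valued_le_one_iff_mem_range_adicCompletionIntegers v) X).mp hX
  have hC := smul_eq_shortModel X he
  set C : VariableChange (v.adicCompletion K) :=
    ⟨Units.mk0 (e / 6) (div_ne_zero he (by exact_mod_cast (by norm_num : (6:ℕ) ≠ 0))),
      -X.b₂ / 12, -X.a₁ / 2, -X.a₃ / 2 + X.a₁ * X.b₂ / 24⟩ with hCdef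
  have hepos : 0 < Valued.v e := zero_lt_iff.mpr ((Valuation.ne_zero_iff _).mpr he)
  have hint' : (C • X).IsIntegral (v.adicCompletionIntegers K) := by
    rw [hC, isIntegral_iff_forall_mem_range]
    simp only [← valued_le_one_iff_mem_range_adicCompletionIntegers, map_zero, zero_le, true_and]
    refine ⟨?_, ?_⟩
    · rw [map_div₀, neg_mul, Valuation.map_neg, map_pow]
      exact (div_le_one₀ (pow_pos hepos 4)).mpr h4
    · rw [map_div₀, neg_mul, Valuation.map_neg, map_pow]
      exact (div_le_one₀ (pow_pos hepos 6)).mpr h6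
  have key := hmin C hint'
  rw [variableChange_Δ] at key
  have hu : ((C.u⁻¹ : (v.adicCompletion K)ˣ) : v.adicCompletion K) = 6 / e := by
    rw [Units.val_inv_eq_inv_val, hCdef, Units.val_mk0, inv_div]
  rw [hu, map_mul, map_pow] at key
  have hΔ0 : Valued.v X.Δ ≠ 0 := (Valuation.ne_zero_iff _).mpr hΔ
  have h1 : Valued.v (6 / e) ^ 12 ≤ 1 := by
    have h2 : Valued.v (6 / e) ^ 12 * Valued.v X.Δ * (Valued.v X.Δ)⁻¹ ≤
        Valued.v X.Δ * (Valued.v X.Δ)⁻¹ := by gcongr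
    rwa [mul_assoc, mul_inv_cancel₀ hΔ0, mul_one] at h2
  have h3 : Valued.v (6 / e) ≤ 1 := by
    by_contra h
    exact absurd h1 (not_le.mpr (one_lt_pow₀ (not_le.mp h) (by norm_num)))
  rw [map_div₀] at h3
  exact (div_le_one₀ hepos).mp h3

end MinimalBound


end WeierstrassCurve

namespace Literature.NumberTheory.EllipticCurves.SzpiroLocal

section Helpers

variable {K : Type*} [Field K] [NumberField K] (v : HeightOneSpectrum (𝓞 K))

/-- `v(n) ≤ 1` for a natural number `n` under any valuation (ultrametric inequality). [folklore] -/
private theorem valuation_natCast_le_one' {L : Type*} [CommRing L] {Γ₀ : Type*}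
    [LinearOrderedCommGroupWithZero Γ₀] (V : Valuation L Γ₀) (n : ℕ) : V (n : L) ≤ 1 := by
  induction n with
  | zero => simp
  | succ n ih =>
    rw [Nat.cast_succ]
    exact (V.map_add _ _).trans (max_le ih (by rw [V.map_one]))

/-- `(exp k)^n = exp (n k)` in `ℤᵐ⁰`. [folklore] -/
private theorem withZero_exp_pow (k : ℤ) (n : ℕ) : WithZero.exp k ^ n = WithZero.exp ((n : ℤ) * k) := by
  rw [← WithZero.exp_nsmul, nsmul_eq_mul]

end Helpers

/-! ## The integer core -/

/-- **Integer core of Silverman AEC Ex. 8.21** («use the minimality of the equation to bound the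
powers of the primes dividing `G = gcd(c₄³, c₆²)`», combined with VIII.11 «`f_p = 2` if additive,
`1` if multiplicative», prime by prime): with `a = ord c₄`, `b = ord c₆`, `d = ord Δ` of a minimal
equation, `t = ord 1728 = 6t₂ + 3t₃`, the three ultrametric constraints from `1728 Δ = c₄³ − c₆²`,
the reduction type (`f`), and `δ = [3a ≠ t + d ∨ 2b ≠ t + d]`:
`d + 6δ ≤ 6f + (t+d−3a)⁺ + 2(3a−t−d)⁺ + 3(2b−t−d)⁺ + 6c` and `6δ ≤ 6f + 2(3a−t−d)⁺ + 3(2b−t−d)⁺ + 6c`,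
`c = 0` if `t₂ = t₃ = 0`, else `c = 3t + 5`; verified by linear arithmetic over all cases.
[cite: SilvermanAEC2009, Ex. 8.21 and VIII.11 (PDF p. 221)] -/
theorem szpiro_local_core (a b d f t₂ t₃ : ℕ)
    (h1 : 3 * a ≤ 2 * b ∨ 6 * t₂ + 3 * t₃ + d ≤ 2 * b)
    (h2 : 2 * b ≤ 3 * a ∨ 6 * t₂ + 3 * t₃ + d ≤ 3 * a)
    (h3 : 3 * a ≤ 6 * t₂ + 3 * t₃ + d ∨ 2 * b ≤ 6 * t₂ + 3 * t₃ + d)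
    (hred : (d = 0 ∧ f = 0) ∨ (0 < d ∧ a = 0 ∧ 1 ≤ f) ∨
      (0 < d ∧ 0 < a ∧ 2 ≤ f ∧ (a < 4 * (t₂ + t₃) + 4 ∨ b < 6 * (t₂ + t₃) + 6)))
    (δ : ℤ) (hδ : δ = 0 ∨ (δ = 1 ∧ (3 * a ≠ 6 * t₂ + 3 * t₃ + d ∨ 2 * b ≠ 6 * t₂ + 3 * t₃ + d))) :
    ((d : ℤ) + 6 * δ
      ≤ 6 * f + max 0 (((6 * t₂ + 3 * t₃ : ℕ) : ℤ) + d - 3 * a)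
          + 2 * max 0 (3 * (a : ℤ) - (((6 * t₂ + 3 * t₃ : ℕ) : ℤ) + d))
          + 3 * max 0 (2 * (b : ℤ) - (((6 * t₂ + 3 * t₃ : ℕ) : ℤ) + d))
          + 6 * (if t₂ + t₃ = 0 then (0 : ℤ) else 3 * (6 * t₂ + 3 * t₃) + 5)) ∧
    (6 * δ
      ≤ 6 * f + 2 * max 0 (3 * (a : ℤ) - (((6 * t₂ + 3 * t₃ : ℕ) : ℤ) + d))
          + 3 * max 0 (2 * (b : ℤ) - (((6 * t₂ + 3 * t₃ : ℕ) : ℤ) + d))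
          + 6 * (if t₂ + t₃ = 0 then (0 : ℤ) else 3 * (6 * t₂ + 3 * t₃) + 5)) := by
  simp only [max_def]
  push_cast
  constructor <;> split_ifs <;> omega

end Literature.NumberTheory.EllipticCurves.SzpiroLocal

namespace WeierstrassCurve

open Literature.NumberTheory.EllipticCurves.SzpiroLocal

section LocalData

variable {K : Type*} [Field K] [NumberField K] (v : HeightOneSpectrum (𝓞 K))
  (W : WeierstrassCurve K)

/-- The chosen local minimal model is `E • W_{K_v}` for some change of variables `E` over `K_v`
(Silverman AEC VII.1, Prop. 1.3(a): minimal equations exist and are reached by a change of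
variables). [cite: SilvermanAEC2009, VII.1 Prop. 1.3(a)] -/
theorem exists_localMinimalModel_eq_smul :
    ∃ E : VariableChange (v.adicCompletion K),
      W.localMinimalModel v = E • W.baseChange (v.adicCompletion K) := ⟨_, rfl⟩

/-- The local minimal model is the base change to `K_v` of the local minimal integral model over
`O_v` (Silverman AEC VII.1: a minimal equation has `v`-integral coefficients).
[cite: SilvermanAEC2009, VII.1 Prop. 1.3(a)] -/
theorem baseChange_localMinimalIntegralModel :
    (W.localMinimalIntegralModel v).baseChange (v.adicCompletion K) = W.localMinimalModel v :=
  baseChange_integralModel_eq _ _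

variable [W.IsElliptic]

/-- `x = c₄³/(1728 Δ) = j/1728` is an isomorphism invariant (Silverman AEC III.1, Table 3.1:
`u⁴ c₄' = c₄`, `u¹² Δ' = Δ`): its image in `K_v` is computed on the local minimal integral model `M`.
[cite: SilvermanAEC2009, III.1 Table 3.1] -/
theorem algebraMap_c₄_cube_div :
    algebraMap K (v.adicCompletion K) (W.c₄ ^ 3 / (1728 * W.Δ)) =
      ((W.localMinimalIntegralModel v).c₄ : v.adicCompletion K) ^ 3 /
        (1728 * ((W.localMinimalIntegralModel v).Δ : v.adicCompletion K)) := by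
  obtain ⟨E, hE⟩ := exists_localMinimalModel_eq_smul v W
  have h4 : ((W.localMinimalIntegralModel v).c₄ : v.adicCompletion K) =
      (W.localMinimalModel v).c₄ := by
    rw [← baseChange_localMinimalIntegralModel v W]; simp [baseChange, map_c₄]
  have hΔ : ((W.localMinimalIntegralModel v).Δ : v.adicCompletion K) =
      (W.localMinimalModel v).Δ := by
    rw [← baseChange_localMinimalIntegralModel v W]; simp [baseChange, map_Δ]
  rw [h4, hΔ, hE, variableChange_c₄, variableChange_Δ]
  simp only [baseChange, map_c₄, map_Δ, map_div₀, map_pow, map_mul, map_ofNat]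
  have hu : ((E.u⁻¹ : (v.adicCompletion K)ˣ) : v.adicCompletion K) ≠ 0 := Units.ne_zero _
  have hΔ0 : algebraMap K (v.adicCompletion K) W.Δ ≠ 0 :=
    (_root_.map_ne_zero _).mpr W.isUnit_Δ.ne_zero
  field_simp

/-- Likewise `c₆²/(1728 Δ) = (j − 1728)/1728` is an isomorphism invariant (Silverman AEC III.1,
Table 3.1: `u⁶ c₆' = c₆`, `u¹² Δ' = Δ`), computed in `K_v` on the local minimal integral model.
[cite: SilvermanAEC2009, III.1 Table 3.1] -/
theorem algebraMap_c₆_sq_div :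
    algebraMap K (v.adicCompletion K) (W.c₆ ^ 2 / (1728 * W.Δ)) =
      ((W.localMinimalIntegralModel v).c₆ : v.adicCompletion K) ^ 2 /
        (1728 * ((W.localMinimalIntegralModel v).Δ : v.adicCompletion K)) := by
  obtain ⟨E, hE⟩ := exists_localMinimalModel_eq_smul v W
  have h6 : ((W.localMinimalIntegralModel v).c₆ : v.adicCompletion K) =
      (W.localMinimalModel v).c₆ := by
    rw [← baseChange_localMinimalIntegralModel v W]; simp [baseChange, map_c₆]
  have hΔ : ((W.localMinimalIntegralModel v).Δ : v.adicCompletion K) =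
      (W.localMinimalModel v).Δ := by
    rw [← baseChange_localMinimalIntegralModel v W]; simp [baseChange, map_Δ]
  rw [h6, hΔ, hE, variableChange_c₆, variableChange_Δ]
  simp only [baseChange, map_c₆, map_Δ, map_div₀, map_pow, map_mul, map_ofNat]
  have hu : ((E.u⁻¹ : (v.adicCompletion K)ˣ) : v.adicCompletion K) ≠ 0 := Units.ne_zero _
  have hΔ0 : algebraMap K (v.adicCompletion K) W.Δ ≠ 0 :=
    (_root_.map_ne_zero _).mpr W.isUnit_Δ.ne_zero
  field_simp

/-- **Minimality constraint on the local minimal model** (Silverman AEC VII.1 with Ex. 8.21, over a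
number field): if `ord_v c₄(M) ≥ a`, `ord_v c₆(M) ≥ b` and `ord_v 6 = t₆` for the local minimal
integral model `M` at `v`, then `a < 4 t₆ + 4` or `b < 6 t₆ + 6` (otherwise rescaling
`y² = x³ − 27 c₄ x − 54 c₆` by `6 π^{t₆+1}` gives an integral equation of smaller discriminant order).
[cite: SilvermanAEC2009, VII.1 Remark 1.1 and Ex. 8.21] -/
theorem localMinimal_ord_c₄_c₆_lt (a b t₆ : ℕ)
    (ha : Valued.v ((W.localMinimalIntegralModel v).c₄ : v.adicCompletion K) ≤
      WithZero.exp (-(a : ℤ)))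
    (hb : Valued.v ((W.localMinimalIntegralModel v).c₆ : v.adicCompletion K) ≤
      WithZero.exp (-(b : ℤ)))
    (ht : Valued.v ((6 : v.adicCompletionIntegers K) : v.adicCompletion K) =
      WithZero.exp (-(t₆ : ℤ))) :
    a < 4 * t₆ + 4 ∨ b < 6 * t₆ + 6 := by
  by_contra hcon
  push Not at hcon
  obtain ⟨h4, h6⟩ := hcon
  haveI : (W.localMinimalModel v).IsMinimal (v.adicCompletionIntegers K) := inferInstance
  have hc4 : ((W.localMinimalIntegralModel v).c₄ : v.adicCompletion K) =
      (W.localMinimalModel v).c₄ := by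
    rw [← baseChange_localMinimalIntegralModel v W]; simp [baseChange, map_c₄]
  have hc6 : ((W.localMinimalIntegralModel v).c₆ : v.adicCompletion K) =
      (W.localMinimalModel v).c₆ := by
    rw [← baseChange_localMinimalIntegralModel v W]; simp [baseChange, map_c₆]
  have hΔ : (W.localMinimalModel v).Δ ≠ 0 := by
    rw [← baseChange_localMinimalIntegralModel v W]
    simp only [baseChange, map_Δ]
    intro h0
    exact localMinimalIntegralModel_Δ_ne_zero v W (by
      have : Function.Injective (algebraMap (v.adicCompletionIntegers K) (v.adicCompletion K)) :=
        IsFractionRing.injective _ _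
      exact this (by rw [h0, map_zero]))
  obtain ⟨π, hπ⟩ := v.valuation_exists_uniformizer K
  have hπv : Valued.v (algebraMap K (v.adicCompletion K) π) = WithZero.exp (-1 : ℤ) := by
    rw [valued_algebraMap_adicCompletion, hπ]
  have h6v : Valued.v (6 : v.adicCompletion K) = WithZero.exp (-(t₆ : ℤ)) := by
    rw [← ht,  show ((6 : v.adicCompletionIntegers K) : v.adicCompletion K) = (6 : v.adicCompletion K)
      from map_ofNat (algebraMap (v.adicCompletionIntegers K) (v.adicCompletion K)) 6]
  have h60 : Valued.v (6 : v.adicCompletion K) ≠ 0 := by rw [h6v]; exact WithZero.exp_ne_zero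
  set e : v.adicCompletion K := 6 * algebraMap K (v.adicCompletion K) π with he_def
  have hev : Valued.v e = WithZero.exp (-((t₆ : ℤ) + 1)) := by
    rw [he_def, map_mul, h6v, hπv, ← WithZero.exp_add]; congr 1; ring
  have he : e ≠ 0 := by
    intro h0; rw [h0, map_zero] at hev; exact WithZero.exp_ne_zero hev.symm
  have key := valued_six_le_of_isMinimal v (W.localMinimalModel v) hΔ he ?_ ?_
  · rw [h6v, hev, WithZero.exp_le_exp] at key
    omega
  · rw [map_mul, ← hc4, hev, withZero_exp_pow]
    calc Valued.v (27 : v.adicCompletion K) *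
          Valued.v ((W.localMinimalIntegralModel v).c₄ : v.adicCompletion K)
        ≤ 1 * WithZero.exp (-(a : ℤ)) := by
          gcongr
          · exact_mod_cast valuation_natCast_le_one' Valued.v 27
      _ ≤ WithZero.exp ((4 : ℕ) * (-((t₆ : ℤ) + 1))) := by
          rw [one_mul, WithZero.exp_le_exp]; push_cast; omega
  · rw [map_mul, ← hc6, hev, withZero_exp_pow]
    calc Valued.v (54 : v.adicCompletion K) *
          Valued.v ((W.localMinimalIntegralModel v).c₆ : v.adicCompletion K)
        ≤ 1 * WithZero.exp (-(b : ℤ)) := by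
          gcongr
          · exact_mod_cast valuation_natCast_le_one' Valued.v 54
      _ ≤ WithZero.exp ((6 : ℕ) * (-((t₆ : ℤ) + 1))) := by
          rw [one_mul, WithZero.exp_le_exp]; push_cast; omega


end LocalData

end WeierstrassCurve
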